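import Summits.QuantumFields.YangMills.Theorems.BalabanLadderNTCouplingSumRule
import HarnessLib

/-!
# Crux `NT` (stmt-QuantumFields-19353): the zero-momentum sum rule, III — THIRD ORDER: the `z`-summed torus third cumulant is
# the coupling derivative of the two-point function; its volume-uniform β-budget at weak coupling (hypothesis-free)

Sequel of `Theorems/BalabanLadderNTCouplingSumRule` (fleet lead prover of crux `NT`, unit `ym-spine-19353-p1`, g8); general compact
`G`, any lattice representation `r`, every odd torus.  Clause (ii) of `LowerBounds G r a` floors
`|Q3_{β,L,a}(f, g, h)| = |Σ_{x,y,z} f g h · κ₃,T(x, y, z)|` (`torusK3`).  The crux idea `Cruxes/NT/Ideas/skewness-from-asymptotic-freedom.md`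
(§Mechanism 2) runs on the lattice ACTION SUM RULE `Σ_z κ₃(A_x, A_y, A_z) = ∂_β Cov(A_x, A_y)`; the tree had it with the Wilson
action in the third slot (`SkewResponse.hasDerivAt_torusCov_coupling`).  With part I's dictionary `−S_W = Σ_{z ∈ box L} A_z∘lift − 6N(2L+1)⁴`
(constants drop out of cumulants) this file states it in the route's own letters and draws the weak-coupling budget:

* **`hasDerivAt_torusCov_dens_coupling`** — `∂_β Cov_{T,β}(A_x, A_y) = Σ_{z ∈ box L} torusK3_{β,L}(x, y, z)` (exact, every `β`, `L`,
  `x`, `y`): the zero-momentum mode IN THE THIRD SLOT of clause (ii)'s object is the coupling derivative of clause (i)'s kernel.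
* `continuous_sum_torusK3`, **`integral_sum_torusK3_eq`** — `∫_{β₁}^{β₂} Σ_z torusK3_{γ,L}(x, y, z) dγ = Cov_{T,β₂}(A_x, A_y) − Cov_{T,β₁}(A_x, A_y)`.
* `one_add_log_div_antitone` (`(1 + log t)/t` is non-increasing on `[1, ∞)`) and **`exists_abs_integral_sum_torusK3_le`** — with the
  tree's volume-uniform weak-coupling covariance bound (`AfOnset.exists_abs_torusCov_dens_le`, `|Cov_T(A_x, A_y)| ≤ W(1 + log β)²/β²`):
  `|∫_{β₁}^{β₂} Σ_z torusK3_{γ,L}(x, y, z) dγ| ≤ 2W(1 + log β₁)²/β₁²` for all `L ≥ 1`, `1 ≤ β₁ ≤ β₂`, `x`, `y` — the `z`-summed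
  third cumulant has an `O(log²β/β²)` β-budget on `[β, ∞)`, i.e. averages to `O(log²β/β³)` over every window `[β, 2β]`,
  uniformly in the volume.

Reading: these are the `k_z = 0` statements; clause (ii)'s witness `h` is compactly supported at scale `a(β)`, i.e. lives at
lattice momenta `|k| ≍ a(β)`, about which nothing is claimed.  No sign of `κ₃`, no floor, nothing of NT, the seam or the gap.  Not Clay.
-/

set_option autoImplicit false

noncomputable section

open MeasureTheory Filter Topology Finset
open scoped BigOperators
open Literature.MathematicalPhysics.QuantumFieldTheory hiding ZdEdge
open Literature.MathematicalPhysics.QuantumLattice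
open Literature.Probability.LatticeModels (Site box mem_box card_box)
open Summit.QuantumFields.YangMills.Cruxes.OSLegsFromFemtoAndGap.DlrCollarTransfer
open Summit.QuantumFields.YangMills.Cruxes.OSLegsFromFemtoAndGap.DlrCollarTransfer.StubLower (exists_abs_dens_le)
open Summit.QuantumFields.YangMills.Cruxes.UVSeamRec.ResponsePinning (integrable_comp_lift)
open Summit.QuantumFields.YangMills.Cruxes.IR.AfOnset (exists_abs_torusCov_dens_le)
open Summit.QuantumFields.YangMills.Cruxes.NT.SkewResponse (hasDerivAt_torusCov_coupling)

namespace Summit.QuantumFields.YangMills.Cruxes.NT.CouplingSumRule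

/-- `(1 + log t)/t` is non-increasing on `[1, ∞)`: for `1 ≤ s ≤ t`, `(1 + log t)/t ≤ (1 + log s)/s`
(`log(t/s) ≤ t/s − 1`). [folklore] -/
theorem one_add_log_div_antitone {s t : ℝ} (hs : 1 ≤ s) (hst : s ≤ t) :
    (1 + Real.log t) / t ≤ (1 + Real.log s) / s := by
  have hs0 : 0 < s := lt_of_lt_of_le one_pos hs
  have ht0 : 0 < t := lt_of_lt_of_le hs0 hst
  have hls : 0 ≤ Real.log s := Real.log_nonneg hs
  have hlog : Real.log t - Real.log s ≤ t / s - 1 := by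
    rw [← Real.log_div ht0.ne' hs0.ne']
    exact Real.log_le_sub_one_of_pos (div_pos ht0 hs0)
  rw [div_le_div_iff₀ ht0 hs0]
  have h1 : s * (Real.log t - Real.log s) ≤ t - s := by
    have := mul_le_mul_of_nonneg_left hlog hs0.le
    have e : s * (t / s - 1) = t - s := by
      rw [mul_sub, mul_one, mul_div_assoc', mul_div_cancel_left₀ t hs0.ne']
    linarith
  nlinarith [mul_le_mul_of_nonneg_right hst hls]

/-- `(1 + log t)²/t²` is non-increasing on `[1, ∞)`. [folklore] -/
theorem one_add_log_sq_div_sq_antitone {s t : ℝ} (hs : 1 ≤ s) (hst : s ≤ t) :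
    (1 + Real.log t) ^ 2 / t ^ 2 ≤ (1 + Real.log s) ^ 2 / s ^ 2 := by
  have hs0 : 0 < s := lt_of_lt_of_le one_pos hs
  have ht0 : 0 < t := lt_of_lt_of_le hs0 hst
  have hlt : 0 ≤ 1 + Real.log t := by have := Real.log_nonneg (hs.trans hst); linarith
  have h := one_add_log_div_antitone hs hst
  rw [← div_pow, ← div_pow]
  exact pow_le_pow_left₀ (div_nonneg hlt ht0.le) h 2

section Main

variable (G : Type) [Group G] [TopologicalSpace G] [IsTopologicalGroup G] [CompactSpace G]
  [MeasurableSpace G] [BorelSpace G] (r : LatticeRep G)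

/-- Integration against the summed density: for a continuous observable `F` of the lift,
`∫ F∘lift · (Σ_{z ∈ box L} A_z∘lift − C) = Σ_z ∫ F∘lift · A_z∘lift − C ∫ F∘lift`. [folklore] -/
theorem integral_mul_sum_dens_sub_const (β : ℝ) (L : ℕ) {F : LGConfig 4 G → ℝ} (hF : Continuous F) (C : ℝ) :
    ∫ U, F (torusLift (2 * L + 1) U) * ((∑ z ∈ box 4 L, dens G r z (torusLift (2 * L + 1) U)) - C)
        ∂(wilsonMeasure (d := 4) (L := 2 * L + 1) r.ρ β) =
      (∑ z ∈ box 4 L, ∫ U, F (torusLift (2 * L + 1) U) * dens G r z (torusLift (2 * L + 1) U)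
        ∂(wilsonMeasure (d := 4) (L := 2 * L + 1) r.ρ β)) -
        C * ∫ U, F (torusLift (2 * L + 1) U) ∂(wilsonMeasure (d := 4) (L := 2 * L + 1) r.ρ β) := by
  have iF := integrable_comp_lift r β L hF
  have iFD : ∀ z, Integrable (fun U : GaugeConfig 4 (2 * L + 1) G =>
      F (torusLift (2 * L + 1) U) * dens G r z (torusLift (2 * L + 1) U)) (wilsonMeasure (d := 4) (L := 2 * L + 1) r.ρ β) :=
    fun z => integrable_comp_lift r β L (F := fun V => F V * dens G r z V) (hF.mul (continuous_dens r z))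
  have hpt : (fun U : GaugeConfig 4 (2 * L + 1) G => F (torusLift (2 * L + 1) U) *
        ((∑ z ∈ box 4 L, dens G r z (torusLift (2 * L + 1) U)) - C)) =
      fun U => (∑ z ∈ box 4 L, F (torusLift (2 * L + 1) U) * dens G r z (torusLift (2 * L + 1) U)) -
        C * F (torusLift (2 * L + 1) U) := by
    funext U; rw [mul_sub, Finset.mul_sum]; ring
  rw [hpt, integral_sub (integrable_finsetSum _ fun z _ => iFD z) (iF.const_mul C),
    integral_finsetSum _ (fun z _ => iFD z), integral_const_mul]

/-- **Third-order zero-momentum sum rule.**  For every `β`, `L`, `x`, `y`: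
`∂_β Cov_{T,β}(A_x, A_y) = Σ_{z ∈ box L} torusK3_{β,L}(x, y, z)` — the coupling derivative of the torus two-point function of the action
density is its torus third cumulant summed over the third site (`SkewResponse.hasDerivAt_torusCov_coupling` with
`−S_W = Σ_z A_z∘lift − 6N(2L+1)⁴`; the constant cancels from the five-term cumulant). [folklore] -/
theorem hasDerivAt_torusCov_dens_coupling (β : ℝ) (L : ℕ) (x y : Fin 4 → ℤ) :
    HasDerivAt (fun β' => torusE G r β' L (fun V => dens G r x V * dens G r y V) -
        torusE G r β' L (dens G r x) * torusE G r β' L (dens G r y))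
      (∑ z ∈ box 4 L, torusK3 G r β L x y z) β := by
  haveI := r.secondCountableTopology
  haveI := isProbabilityMeasure_wilsonMeasure (d := 4) (L := 2 * L + 1) r.ρ r.continuous β
  obtain ⟨M, -, hM⟩ := exists_abs_dens_le G r
  have hd := hasDerivAt_torusCov_coupling G r β L (continuous_dens r x) (continuous_dens r y) (hM x) (hM y)
  refine hd.congr_deriv ?_
  set C : ℝ := 6 * (r.N : ℝ) * ((2 * L + 1 : ℕ) : ℝ) ^ 4 with hC
  have hS : ∀ U : GaugeConfig 4 (2 * L + 1) G, -wilsonAction (d := 4) (L := 2 * L + 1) r.ρ U =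
      (∑ z ∈ box 4 L, dens G r z (torusLift (2 * L + 1) U)) - C := by
    intro U; rw [sum_box_dens_torusLift]; ring
  simp_rw [hS]
  have e1 := integral_mul_sum_dens_sub_const G r β L (F := fun V => dens G r x V * dens G r y V)
    ((continuous_dens r x).mul (continuous_dens r y)) C
  have e2 := integral_mul_sum_dens_sub_const G r β L (continuous_dens r y) C
  have e3 := integral_mul_sum_dens_sub_const G r β L (continuous_dens r x) C
  have e4 := integral_mul_sum_dens_sub_const G r β L (F := fun _ => (1 : ℝ)) continuous_const C
  simp only [one_mul] at e4
  rw [integral_const, probReal_univ, one_smul] at e4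
  rw [e1, e2, e3, e4]
  unfold torusK3 torusE
  simp only [Finset.sum_add_distrib, Finset.sum_sub_distrib, ← Finset.mul_sum, ← Finset.sum_mul]
  ring

/-- The `z`-summed third cumulant `β ↦ Σ_z torusK3_{β,L}(x, y, z)` is continuous in the coupling. [folklore] -/
theorem continuous_sum_torusK3 (L : ℕ) (x y : Fin 4 → ℤ) :
    Continuous fun β => ∑ z ∈ box 4 L, torusK3 G r β L x y z := by
  obtain ⟨M, -, hM⟩ := exists_abs_dens_le G r
  have hMM : ∀ (u v : Fin 4 → ℤ) (V : LGConfig 4 G), |dens G r u V * dens G r v V| ≤ M * M := fun u v V => by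
    rw [abs_mul]
    exact mul_le_mul (hM u V) (hM v V) (abs_nonneg _) ((abs_nonneg _).trans (hM u V))
  have hMMM : ∀ (u v w : Fin 4 → ℤ) (V : LGConfig 4 G), |dens G r u V * dens G r v V * dens G r w V| ≤ M * M * M :=
    fun u v w V => by
    rw [abs_mul]
    exact mul_le_mul (hMM u v V) (hM w V) (abs_nonneg _) ((abs_nonneg _).trans (hMM u v V))
  have c1 : ∀ u : Fin 4 → ℤ, Continuous fun β => torusE G r β L (dens G r u) :=
    fun u => continuous_torusE_coupling G r L (continuous_dens r u) (hM u)
  have c2 : ∀ u v : Fin 4 → ℤ, Continuous fun β => torusE G r β L (fun V => dens G r u V * dens G r v V) :=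
    fun u v => continuous_torusE_coupling G r L ((continuous_dens r u).mul (continuous_dens r v)) (hMM u v)
  have c3 : ∀ u v w : Fin 4 → ℤ, Continuous fun β => torusE G r β L
      (fun V => dens G r u V * dens G r v V * dens G r w V) := fun u v w =>
    continuous_torusE_coupling G r L (((continuous_dens r u).mul (continuous_dens r v)).mul (continuous_dens r w))
      (hMMM u v w)
  refine continuous_finsetSum _ fun z _ => ?_
  unfold torusK3
  exact ((((c3 x y z).sub ((c1 x).mul (c2 y z))).sub ((c1 y).mul (c2 x z))).sub ((c1 z).mul (c2 x y))).add
    (continuous_const.mul (((c1 x).mul (c1 y)).mul (c1 z)))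

/-- **Integrated third-order sum rule**: `∫_{β₁}^{β₂} Σ_z torusK3_{γ,L}(x, y, z) dγ = Cov_{T,β₂}(A_x, A_y) − Cov_{T,β₁}(A_x, A_y)`.
[folklore] -/
theorem integral_sum_torusK3_eq (L : ℕ) (x y : Fin 4 → ℤ) (β₁ β₂ : ℝ) :
    ∫ γ in β₁..β₂, ∑ z ∈ box 4 L, torusK3 G r γ L x y z =
      (torusE G r β₂ L (fun V => dens G r x V * dens G r y V) - torusE G r β₂ L (dens G r x) * torusE G r β₂ L (dens G r y)) -
      (torusE G r β₁ L (fun V => dens G r x V * dens G r y V) - torusE G r β₁ L (dens G r x) * torusE G r β₁ L (dens G r y)) :=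
  intervalIntegral.integral_eq_sub_of_hasDerivAt (fun γ _ => hasDerivAt_torusCov_dens_coupling G r γ L x y)
    ((continuous_sum_torusK3 G r L x y).intervalIntegrable _ _)

/-- **β-budget of the `z`-summed third cumulant, uniformly in the volume.**  There is `W ≥ 0` (the tree's weak-coupling constant
of `AfOnset.exists_abs_torusCov_dens_le`) with `|∫_{β₁}^{β₂} Σ_z torusK3_{γ,L}(x, y, z) dγ| ≤ 2W(1 + log β₁)²/β₁²` for all `L ≥ 1`,
`1 ≤ β₁ ≤ β₂`, `x`, `y`: the `k_z = 0` mode of clause (ii)'s object averages to `O(log²β/β³)` over every window `[β, 2β]`. [folklore] -/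
theorem exists_abs_integral_sum_torusK3_le :
    ∃ W : ℝ, 0 ≤ W ∧ ∀ (L : ℕ), 1 ≤ L → ∀ β₁ β₂ : ℝ, 1 ≤ β₁ → β₁ ≤ β₂ → ∀ x y : Fin 4 → ℤ,
      |∫ γ in β₁..β₂, ∑ z ∈ box 4 L, torusK3 G r γ L x y z| ≤ 2 * W * (1 + Real.log β₁) ^ 2 / β₁ ^ 2 := by
  obtain ⟨W, hW0, hW⟩ := exists_abs_torusCov_dens_le (G := G) r
  refine ⟨W, hW0, fun L hL β₁ β₂ hβ₁ hβ₁₂ x y => ?_⟩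
  rw [integral_sum_torusK3_eq]
  have h1 := hW L hL β₁ hβ₁ x y
  have h2 := hW L hL β₂ (hβ₁.trans hβ₁₂) x y
  have hmono : W * (1 + Real.log β₂) ^ 2 / β₂ ^ 2 ≤ W * (1 + Real.log β₁) ^ 2 / β₁ ^ 2 := by
    rw [mul_div_assoc, mul_div_assoc]
    exact mul_le_mul_of_nonneg_left (one_add_log_sq_div_sq_antitone hβ₁ hβ₁₂) hW0
  calc _ ≤ |torusE G r β₂ L (fun V => dens G r x V * dens G r y V) - torusE G r β₂ L (dens G r x) * torusE G r β₂ L (dens G r y)| +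
        |torusE G r β₁ L (fun V => dens G r x V * dens G r y V) - torusE G r β₁ L (dens G r x) * torusE G r β₁ L (dens G r y)| :=
        abs_sub _ _
    _ ≤ W * (1 + Real.log β₁) ^ 2 / β₁ ^ 2 + W * (1 + Real.log β₁) ^ 2 / β₁ ^ 2 := add_le_add (h2.trans hmono) h1
    _ = 2 * W * (1 + Real.log β₁) ^ 2 / β₁ ^ 2 := by ring

end Main

end Summit.QuantumFields.YangMills.Cruxes.NT.CouplingSumRule

end
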